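import Literature.MathematicalPhysics.QuantumFieldTheory.Balaban1983to89.Beta.ComposedRoad
import Literature.MathematicalPhysics.QuantumFieldTheory.Balaban1983to89.Beta.KernelSpecIdentityForm
import Literature.MathematicalPhysics.QuantumFieldTheory.Balaban1983to89.Beta.MinimiserIdentityForm

/-!
# Beta / ComposedRoadFromSpec — THE WALL WITH THE (O1′) HYPOTHESIS IN ITS FINAL TYPE: `hid` REPLACED by kernel-represented
# `InfiniteVolumeSpec` instances + Hessian kernel data + the `hident`-side identification `hβ` (RULINGS (R11-F) v7 / (R14-1)/(R14-3))

HONEST FRAMING (page 1 of everything the β sub-cell writes): discharging `BetaPertH` makes Bałaban's UV stability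
UNCONDITIONAL — a real constructive-QFT result; it is NOT the continuum limit and NOT the Clay problem.  This module is
CLASS-LEVEL ASSEMBLY by the BETA lead (unit `b2b-balaban-strat-b12` gen 8; BETA-SPEC §7.25 (b) (R14-1)/(R14-3), §7.26): it composes
LANDED kernel files (`ComposedRoad` v1.5, b12 `KernelSpecIdentityForm` p182951, an2 `KernelSpecInstance` p183734 / `MinimiserIdentityForm` p184034) and asserts nothing printed by Bałaban; every statement is [folklore] bookkeeping over the cell's carriers.

## What

`ComposedRoad.endpointExistence_of_composedLegInterfacePow_identity_avg_remainderConst` (lead, v1.5 §10) is the wall with the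
base-point-averaged identification `hident_avg` and the exact-telescoping binder `hid : IdentityForm μC S.β0`.  b12-g12's
`KernelSpecIdentityForm.identityForm_of_specFamilies'` (p182951) produces `IdentityForm μC β0` for
`μC j k := F (coarseTensor (Nf j k) (w j k) (T j))` from: kernel-represented affine-reproducing specs `S j k : InfiniteVolumeSpec 4 (Nf j k)`
with `(S j k).H = kernelOpSum (Nf j k) (w j k)` and `AbsMoment₂` response columns (an2 `AffineReproduction` + b12
`KernelRepresentationSummable`), Hessian kernels `T j` with `AbsMoment₂` entries and (T0)/(T1) (an2 `DressedMomentNormalisation`),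
ANY read-out `F` of the second-moment tensor, and the identification `hβ : ∀ j, β0 j = F (m2Tensor (T j))` (the `hident` side).
THIS FILE substitutes the latter for `hid`:

* `endpointExistence_of_composedLegInterfacePow_specFamilies_avg_remainderConst` — the END statement `EndpointExistence Cn` from the
  §10 averaged leg-level binders with `μC := fun j k => F (coarseTensor (Nf j k) (w j k) (T j))`, the spec family data
  `(Nf, S, w, hwA, hrep)`, the Hessian data `(T, hTA, hT0, hT1)`, `F`, `hβ : ∀ j, Sβ.β0 j = F (m2Tensor (T j))`, and the downstream
  binders (`RemainderConst`, `rr ≤ stepBal`, `BetaContH`, `BetaUpperH`) verbatim;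
* `…_of_symmetries` — the same with (T0)/(T1) discharged from divergence-freeness + midpoint inversion of each `T j`
  (`KernelSpecIdentityForm.identityForm_of_specFamilies_of_symmetries`);
* `oneLoopDrift_of_composedLegInterfacePow_specFamilies_avg` — the drift-level form.

So the (O1′) hypothesis of the wall now READS, in the kernel: «at every pair j < k an `InfiniteVolumeSpec 4 (Nf j k)` whose `H` IS the
summable kernel operator of a block-covariant kernel `w j k` with `AbsMoment₂` columns» — by `AffineLiftSpec` the TYPE alone is trivially
inhabited, so the content is `hrep` for the response kernels of the TYPED U = 1 block-averaging KKT system (route P1-K: an2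
`BlochFibreUniqueness`/`BlochFibreMatrix`/`KernelSpecInstance`, lit2 `FibreInverseDecay`) — plus `hβ`, which together with `hident_avg`
is the one-loop representation content (D1)/(I2-b).  Nothing of it is supplied here.

## §2 — ZERO MINIMISER-SIDE BINDERS (an2 `KernelSpecInstance` p183734 + `MinimiserIdentityForm` p184034)

With an2's instance `specK` (all nine fields of `InfiniteVolumeSpec` PROVED for the kernel-sum solution operator of the typed system,
`specK_H = kernelOpSum N wH` by `rfl`, `absMoment₂_wH`) the binders `(Nf, S, w, hwA, hrep)` of §1 are DISCHARGED at the cell's geometric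
block sizes `Nf j k = Lc ^ (k − j)`: `endpointExistence_of_composedLegInterfacePow_minimiser_avg_remainderConst` (Hessian data with
(T0)/(T1)) and `…_of_symmetries` (divergence-free + midpoint-inversion Hessian kernels) take ONLY the §10 leg binders, the Hessian
kernels `T j` with `AbsMoment₂`, the read-out `F`, `hβ`, `hident` for `μC j k := F (coarseTensor (Lc^(k−j)) (wK (Lc^(k−j))) (T j))`,
and the downstream binders — the wall's `hid` hypothesis is GONE for the typed system (an2's `identityForm_of_minimiserFamilies'` /
`_of_symmetries`).  What these END statements are ABOUT is fixed by the reading clause below.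

## READING CLAUSE (W-KKT-2) — what these END statements are ABOUT (beta-ref G-beta-26 / R269; lead wording 2026-08-19T04:47Z)

«Minimiser kernel» in this file and in its imports means: the solution operator of the TYPED U = 1 block-averaging KKT system
`AffineReproduction.InfiniteVolumeSpec` (𝒬 = straight-contour block sums `contourSum`, Euler–Lagrange operator `curvAdj ∘ curv` with
constraint and gauge multipliers, weak gauge).  The IDENTIFICATION of that typed system with Bałaban's U = 1 gauge-fixed linearised
minimiser H_k of [Balaban1987RG1, p. 264 (1.20)] / [Balaban1985BackgroundPropagators, (3.21)–(3.26)] / [Balaban1984PropagatorsI, p. 26 (1.48)–(1.49)]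
is READING (Y15)(b) of the sub-cell (records certificate C-lit2g9-4; cell label DICT-KKT) and is NOT proved here or anywhere in
the tree; the images corollary identifying the torus objects of print with periodised ℤ⁴ kernels is item (an2-D5).  Every END
statement below is therefore a statement about the typed system's kernels `w j k`, carried to Bałaban's objects only under that
reading.  This clause is a header clause, not a Lean hypothesis: readings are dictionary, no `Prop` is minted for them.
-/

noncomputable section

namespace Literature.MathematicalPhysics.QuantumFieldTheory.Balaban1983to89.Beta.ComposedRoadFromSpec

open Finset
open Literature.Probability.LatticeModels (annulus)
open Literature.MathematicalPhysics.QuantumFieldTheory.Balaban1983to89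
open FlowStep FlowStepRuns DagBinding
open Literature.MathematicalPhysics.QuantumFieldTheory.Balaban1983to89.Beta.TransverseStructure (E4)
open Literature.MathematicalPhysics.QuantumFieldTheory.Balaban1983to89.Beta.LeadingCoefficient (leadingIntegrand kappaBal transverseValue)
open Literature.MathematicalPhysics.QuantumFieldTheory.Balaban1983to89.Beta.DyadicShell (Pt toReal supNorm)
open Literature.MathematicalPhysics.QuantumFieldTheory.Balaban1983to89.Beta.BubbleTransfer (Leg contBubble bubbleConst)
open Literature.MathematicalPhysics.QuantumFieldTheory.Balaban1983to89.Beta.Drift (OneLoopDrift)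
open Literature.MathematicalPhysics.QuantumFieldTheory.Balaban1983to89.Beta.RemainderChain (RemainderConst)
open Literature.MathematicalPhysics.QuantumFieldTheory.Balaban1983to89.Beta.MarginalTelescoping (composedCoeff IdentityForm)
open Literature.MathematicalPhysics.QuantumFieldTheory.Balaban1983to89.Beta.LargeLWindow.WindowDecomposition (constA)
open AffineReproduction (InfiniteVolumeSpec)
open DecimatedMomentSummable (AbsMoment₂)
open DressedMomentNormalisation (EKer coarseTensor m2Tensor)
open KernelRepresentationSummable (kernelOpSum)
open KernelSpecIdentityForm (DivFree MidInv identityForm_of_specFamilies' identityForm_of_specFamilies_of_symmetries)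
open MinimiserIdentityForm (wK identityForm_of_minimiserFamilies' identityForm_of_minimiserFamilies_of_symmetries)
open ComposedRoad

variable {ι : Type*} {s : Finset ι} {cc₀ : ι → ℝ} {P Q : ι → Leg} {κB : Type*}

/-- **THE WALL'S DRIFT FROM SPEC FAMILIES (base-point-averaged legs).**  `ComposedRoad.oneLoopDrift_of_composedLegInterfacePow_identity_avg`
with `μC j k := F (coarseTensor (Nf j k) (w j k) (T j))` and `hid` supplied by b12's `identityForm_of_specFamilies'` from kernel-represented
specs, Hessian kernel data and the `hident`-side identification `hβ`. [folklore] -/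
theorem oneLoopDrift_of_composedLegInterfacePow_specFamilies_avg {β : HBeta} (Sβ : B12Beta.OneLoopSplit β)
    (hdeg : ∀ i ∈ s, (P i).a + (Q i).a = 6) {μ ν : Fin 4} (hμν : μ ≠ ν) {N : ℝ} (hN : N ≠ 0)
    (hval : ∀ x : E4, x ≠ 0 → x μ * x ν * contBubble s cc₀ P Q x = leadingIntegrand (kappaBal N) μ ν x)
    {Lc : ℕ} (hL : 2 ≤ Lc)
    -- the (O1′) data in its final type
    (Nf : ℕ → ℕ → ℕ) (hNf : ∀ j k, j < k → Nf j k ≠ 0)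
    (S : ∀ j k : ℕ, j < k → InfiniteVolumeSpec 4 (Nf j k)) (w : ℕ → ℕ → EKer 4) (T : ℕ → EKer 4)
    (hwA : ∀ j k, j < k → ∀ κ l, AbsMoment₂ (w j k κ l))
    (hrep : ∀ j k (hjk : j < k), (S j k hjk).H = kernelOpSum (Nf j k) (w j k))
    (hTA : ∀ j c e, AbsMoment₂ (T j c e)) (hT0 : ∀ j c e, HasSum (T j c e) 0)
    (hT1 : ∀ j c e (ρ : Fin 4), HasSum (fun t : Fin 4 → ℤ => t ρ • T j c e t) 0)
    (F : (Fin 4 → Fin 4 → Fin 4 → Fin 4 → ℝ) → ℝ) (hβ : ∀ j, Sβ.β0 j = F (m2Tensor (T j)))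
    -- the leg-level binders of §10, verbatim
    {F' G' : κB → ι → ℕ → Pt → ℝ} {R Sg R' S' : ι → ℝ} {δ U cc : ℝ} {M : ℕ → ℕ}
    {Bset : ℕ → Finset κB} {wt : ℕ → κB → ℝ}
    (hwt0 : ∀ n : ℕ, 2 ≤ n → ∀ b ∈ Bset n, 0 ≤ wt n b) (hwt1 : ∀ n : ℕ, 2 ≤ n → ∑ b ∈ Bset n, wt n b = 1)
    (hR : ∀ i ∈ s, 0 ≤ R i) (hS : ∀ i ∈ s, 0 ≤ Sg i) (hR' : ∀ i ∈ s, 0 ≤ R' i) (hS' : ∀ i ∈ s, 0 ≤ S' i) (hδ : 0 < δ)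
    (hc : 1 ≤ cc) (hM : ∀ L : ℕ, 2 ≤ L → 1 ≤ M L ∧ (L : ℝ) ≤ cc * M L) (hML : ∀ L : ℕ, 2 ≤ L → M L ≤ L)
    (hF : ∀ m : ℕ, 1 ≤ m → ∀ b ∈ Bset (Lc ^ m), ∀ w' ∈ annulus 4 0 (M (Lc ^ m)), ∀ i ∈ s,
      |F' b i (Lc ^ m) w' - (P i).f (Lc ^ m) 0 w'| ≤ R i / ((supNorm w' : ℝ) ^ ((P i).a - 2) * ((Lc ^ m : ℕ) : ℝ) ^ 2))
    (hG : ∀ m : ℕ, 1 ≤ m → ∀ b ∈ Bset (Lc ^ m), ∀ w' ∈ annulus 4 0 (M (Lc ^ m)), ∀ i ∈ s,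
      |G' b i (Lc ^ m) w' - (Q i).f (Lc ^ m) 0 w'| ≤ Sg i / ((supNorm w' : ℝ) ^ ((Q i).a - 2) * ((Lc ^ m : ℕ) : ℝ) ^ 2))
    (hFtail : ∀ m : ℕ, 1 ≤ m → ∀ b ∈ Bset (Lc ^ m), ∀ r : ℕ, M (Lc ^ m) ≤ r → ∀ w' ∈ annulus 4 r (r + 1), ∀ i ∈ s,
      |F' b i (Lc ^ m) w'| ≤ R' i / ((r : ℝ) + 1) ^ (P i).a * Real.exp (-(δ / ((Lc ^ m : ℕ) : ℝ)) * ((r : ℝ) + 1)))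
    (hGtail : ∀ m : ℕ, 1 ≤ m → ∀ b ∈ Bset (Lc ^ m), ∀ r : ℕ, M (Lc ^ m) ≤ r → ∀ w' ∈ annulus 4 r (r + 1), ∀ i ∈ s,
      |G' b i (Lc ^ m) w'| ≤ S' i / ((r : ℝ) + 1) ^ (Q i).a)
    (hident : ∀ m : ℕ, 1 ≤ m → ∃ R₀ : ℕ, M (Lc ^ m) ≤ R₀ ∧
      |composedCoeff (fun j k => F (coarseTensor (Nf j k) (w j k) (T j))) m
        - ∑ b ∈ Bset (Lc ^ m), wt (Lc ^ m) b * ∑ w' ∈ annulus 4 0 R₀, toReal w' μ * toReal w' ν *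
          ∑ i ∈ s, cc₀ i * (F' b i (Lc ^ m) w' * G' b i (Lc ^ m) w')| ≤ U) :
    OneLoopDrift (B12Normalization.stepBal N Lc)
      (constA (|kappaBal N| * 24 + |kappaBal N| * 110592) (bubbleConst s cc₀ P Q)
          ((80 * (∑ i ∈ s, |cc₀ i| * (R' i * S' i)) * (1 + cc / δ) + U) +
            80 * ∑ i ∈ s, |cc₀ i| * ((((P i).A + (P i).B) * Sg i + R i * ((Q i).A + (Q i).B) + R i * Sg i)))
          cc (kappaBal N * transverseValue)) Sβ.β0 :=
  oneLoopDrift_of_composedLegInterfacePow_identity_avg Sβ hdeg hμν hN hval hL hwt0 hwt1 hR hS hR' hS' hδ hc hM hML hF hG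
    hFtail hGtail hident
    (identityForm_of_specFamilies' Nf hNf S w T hwA hrep hTA hT0 hT1 F hβ)

/-- **THE WALL (END STATEMENT) FROM SPEC FAMILIES.**  `ComposedRoad.endpointExistence_of_composedLegInterfacePow_identity_avg_remainderConst`
with the exact-telescoping binder `hid` REPLACED by: kernel-represented affine-reproducing specs at every pair `j < k` (`S`, `hrep`,
`AbsMoment₂` response columns), Hessian kernels `T j` (`AbsMoment₂`, (T0)/(T1)), a read-out `F`, and `hβ : Sβ.β0 j = F (m2Tensor (T j))`.
The TYPE `InfiniteVolumeSpec` being trivially inhabited (`AffineLiftSpec`), the content of this hypothesis is `hrep` for the actual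
response kernels + `hβ`. [folklore] -/
theorem endpointExistence_of_composedLegInterfacePow_specFamilies_avg_remainderConst {β : HBeta} {Cn : B12.Construction}
    (hgen : ForwardGenerated Cn β) (Sβ : B12Beta.OneLoopSplit β)
    (hdeg : ∀ i ∈ s, (P i).a + (Q i).a = 6) {μ ν : Fin 4} (hμν : μ ≠ ν) {N : ℝ} (hN : N ≠ 0)
    (hval : ∀ x : E4, x ≠ 0 → x μ * x ν * contBubble s cc₀ P Q x = leadingIntegrand (kappaBal N) μ ν x)
    {Lc : ℕ} (hL : 2 ≤ Lc)
    (Nf : ℕ → ℕ → ℕ) (hNf : ∀ j k, j < k → Nf j k ≠ 0)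
    (S : ∀ j k : ℕ, j < k → InfiniteVolumeSpec 4 (Nf j k)) (w : ℕ → ℕ → EKer 4) (T : ℕ → EKer 4)
    (hwA : ∀ j k, j < k → ∀ κ l, AbsMoment₂ (w j k κ l))
    (hrep : ∀ j k (hjk : j < k), (S j k hjk).H = kernelOpSum (Nf j k) (w j k))
    (hTA : ∀ j c e, AbsMoment₂ (T j c e)) (hT0 : ∀ j c e, HasSum (T j c e) 0)
    (hT1 : ∀ j c e (ρ : Fin 4), HasSum (fun t : Fin 4 → ℤ => t ρ • T j c e t) 0)
    (F : (Fin 4 → Fin 4 → Fin 4 → Fin 4 → ℝ) → ℝ) (hβ : ∀ j, Sβ.β0 j = F (m2Tensor (T j)))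
    {F' G' : κB → ι → ℕ → Pt → ℝ} {R Sg R' S' : ι → ℝ} {δ U cc : ℝ} {M : ℕ → ℕ}
    {Bset : ℕ → Finset κB} {wt : ℕ → κB → ℝ}
    (hwt0 : ∀ n : ℕ, 2 ≤ n → ∀ b ∈ Bset n, 0 ≤ wt n b) (hwt1 : ∀ n : ℕ, 2 ≤ n → ∑ b ∈ Bset n, wt n b = 1)
    (hR : ∀ i ∈ s, 0 ≤ R i) (hS : ∀ i ∈ s, 0 ≤ Sg i) (hR' : ∀ i ∈ s, 0 ≤ R' i) (hS' : ∀ i ∈ s, 0 ≤ S' i) (hδ : 0 < δ)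
    (hc : 1 ≤ cc) (hM : ∀ L : ℕ, 2 ≤ L → 1 ≤ M L ∧ (L : ℝ) ≤ cc * M L) (hML : ∀ L : ℕ, 2 ≤ L → M L ≤ L)
    (hF : ∀ m : ℕ, 1 ≤ m → ∀ b ∈ Bset (Lc ^ m), ∀ w' ∈ annulus 4 0 (M (Lc ^ m)), ∀ i ∈ s,
      |F' b i (Lc ^ m) w' - (P i).f (Lc ^ m) 0 w'| ≤ R i / ((supNorm w' : ℝ) ^ ((P i).a - 2) * ((Lc ^ m : ℕ) : ℝ) ^ 2))
    (hG : ∀ m : ℕ, 1 ≤ m → ∀ b ∈ Bset (Lc ^ m), ∀ w' ∈ annulus 4 0 (M (Lc ^ m)), ∀ i ∈ s,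
      |G' b i (Lc ^ m) w' - (Q i).f (Lc ^ m) 0 w'| ≤ Sg i / ((supNorm w' : ℝ) ^ ((Q i).a - 2) * ((Lc ^ m : ℕ) : ℝ) ^ 2))
    (hFtail : ∀ m : ℕ, 1 ≤ m → ∀ b ∈ Bset (Lc ^ m), ∀ r : ℕ, M (Lc ^ m) ≤ r → ∀ w' ∈ annulus 4 r (r + 1), ∀ i ∈ s,
      |F' b i (Lc ^ m) w'| ≤ R' i / ((r : ℝ) + 1) ^ (P i).a * Real.exp (-(δ / ((Lc ^ m : ℕ) : ℝ)) * ((r : ℝ) + 1)))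
    (hGtail : ∀ m : ℕ, 1 ≤ m → ∀ b ∈ Bset (Lc ^ m), ∀ r : ℕ, M (Lc ^ m) ≤ r → ∀ w' ∈ annulus 4 r (r + 1), ∀ i ∈ s,
      |G' b i (Lc ^ m) w'| ≤ S' i / ((r : ℝ) + 1) ^ (Q i).a)
    (hident : ∀ m : ℕ, 1 ≤ m → ∃ R₀ : ℕ, M (Lc ^ m) ≤ R₀ ∧
      |composedCoeff (fun j k => F (coarseTensor (Nf j k) (w j k) (T j))) m
        - ∑ b ∈ Bset (Lc ^ m), wt (Lc ^ m) b * ∑ w' ∈ annulus 4 0 R₀, toReal w' μ * toReal w' ν *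
          ∑ i ∈ s, cc₀ i * (F' b i (Lc ^ m) w' * G' b i (Lc ^ m) w')| ≤ U)
    {rr γ₀ β' : ℝ} (hγ₀ : 0 < γ₀) (hrem : RemainderConst Sβ γ₀ rr) (hr : rr ≤ B12Normalization.stepBal N Lc)
    (hβ' : 0 ≤ β') (hcont : BetaContH γ₀ β) (hup : BetaUpperH β' γ₀ β) : EndpointExistence Cn :=
  endpointExistence_of_composedLegInterfacePow_identity_avg_remainderConst hgen Sβ hdeg hμν hN hval hL hwt0 hwt1 hR hS hR' hS'
    hδ hc hM hML hF hG hFtail hGtail hident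
    (identityForm_of_specFamilies' Nf hNf S w T hwA hrep hTA hT0 hT1 F hβ)
    hγ₀ hrem hr hβ' hcont hup

/-- **… with (T0)/(T1) from the two symmetries of the Hessian kernels** (divergence-freeness + midpoint inversion; b12's
`identityForm_of_specFamilies_of_symmetries`). [folklore] -/
theorem endpointExistence_of_composedLegInterfacePow_specFamilies_avg_remainderConst_of_symmetries {β : HBeta} {Cn : B12.Construction}
    (hgen : ForwardGenerated Cn β) (Sβ : B12Beta.OneLoopSplit β)
    (hdeg : ∀ i ∈ s, (P i).a + (Q i).a = 6) {μ ν : Fin 4} (hμν : μ ≠ ν) {N : ℝ} (hN : N ≠ 0)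
    (hval : ∀ x : E4, x ≠ 0 → x μ * x ν * contBubble s cc₀ P Q x = leadingIntegrand (kappaBal N) μ ν x)
    {Lc : ℕ} (hL : 2 ≤ Lc)
    (Nf : ℕ → ℕ → ℕ) (hNf : ∀ j k, j < k → Nf j k ≠ 0)
    (S : ∀ j k : ℕ, j < k → InfiniteVolumeSpec 4 (Nf j k)) (w : ℕ → ℕ → EKer 4) (T : ℕ → EKer 4)
    (hwA : ∀ j k, j < k → ∀ κ l, AbsMoment₂ (w j k κ l))
    (hrep : ∀ j k (hjk : j < k), (S j k hjk).H = kernelOpSum (Nf j k) (w j k))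
    (hTA : ∀ j c e, AbsMoment₂ (T j c e)) (hdiv : ∀ j, DivFree (T j)) (hinv : ∀ j, MidInv (T j))
    (F : (Fin 4 → Fin 4 → Fin 4 → Fin 4 → ℝ) → ℝ) (hβ : ∀ j, Sβ.β0 j = F (m2Tensor (T j)))
    {F' G' : κB → ι → ℕ → Pt → ℝ} {R Sg R' S' : ι → ℝ} {δ U cc : ℝ} {M : ℕ → ℕ}
    {Bset : ℕ → Finset κB} {wt : ℕ → κB → ℝ}
    (hwt0 : ∀ n : ℕ, 2 ≤ n → ∀ b ∈ Bset n, 0 ≤ wt n b) (hwt1 : ∀ n : ℕ, 2 ≤ n → ∑ b ∈ Bset n, wt n b = 1)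
    (hR : ∀ i ∈ s, 0 ≤ R i) (hS : ∀ i ∈ s, 0 ≤ Sg i) (hR' : ∀ i ∈ s, 0 ≤ R' i) (hS' : ∀ i ∈ s, 0 ≤ S' i) (hδ : 0 < δ)
    (hc : 1 ≤ cc) (hM : ∀ L : ℕ, 2 ≤ L → 1 ≤ M L ∧ (L : ℝ) ≤ cc * M L) (hML : ∀ L : ℕ, 2 ≤ L → M L ≤ L)
    (hF : ∀ m : ℕ, 1 ≤ m → ∀ b ∈ Bset (Lc ^ m), ∀ w' ∈ annulus 4 0 (M (Lc ^ m)), ∀ i ∈ s,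
      |F' b i (Lc ^ m) w' - (P i).f (Lc ^ m) 0 w'| ≤ R i / ((supNorm w' : ℝ) ^ ((P i).a - 2) * ((Lc ^ m : ℕ) : ℝ) ^ 2))
    (hG : ∀ m : ℕ, 1 ≤ m → ∀ b ∈ Bset (Lc ^ m), ∀ w' ∈ annulus 4 0 (M (Lc ^ m)), ∀ i ∈ s,
      |G' b i (Lc ^ m) w' - (Q i).f (Lc ^ m) 0 w'| ≤ Sg i / ((supNorm w' : ℝ) ^ ((Q i).a - 2) * ((Lc ^ m : ℕ) : ℝ) ^ 2))
    (hFtail : ∀ m : ℕ, 1 ≤ m → ∀ b ∈ Bset (Lc ^ m), ∀ r : ℕ, M (Lc ^ m) ≤ r → ∀ w' ∈ annulus 4 r (r + 1), ∀ i ∈ s,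
      |F' b i (Lc ^ m) w'| ≤ R' i / ((r : ℝ) + 1) ^ (P i).a * Real.exp (-(δ / ((Lc ^ m : ℕ) : ℝ)) * ((r : ℝ) + 1)))
    (hGtail : ∀ m : ℕ, 1 ≤ m → ∀ b ∈ Bset (Lc ^ m), ∀ r : ℕ, M (Lc ^ m) ≤ r → ∀ w' ∈ annulus 4 r (r + 1), ∀ i ∈ s,
      |G' b i (Lc ^ m) w'| ≤ S' i / ((r : ℝ) + 1) ^ (Q i).a)
    (hident : ∀ m : ℕ, 1 ≤ m → ∃ R₀ : ℕ, M (Lc ^ m) ≤ R₀ ∧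
      |composedCoeff (fun j k => F (coarseTensor (Nf j k) (w j k) (T j))) m
        - ∑ b ∈ Bset (Lc ^ m), wt (Lc ^ m) b * ∑ w' ∈ annulus 4 0 R₀, toReal w' μ * toReal w' ν *
          ∑ i ∈ s, cc₀ i * (F' b i (Lc ^ m) w' * G' b i (Lc ^ m) w')| ≤ U)
    {rr γ₀ β' : ℝ} (hγ₀ : 0 < γ₀) (hrem : RemainderConst Sβ γ₀ rr) (hr : rr ≤ B12Normalization.stepBal N Lc)
    (hβ' : 0 ≤ β') (hcont : BetaContH γ₀ β) (hup : BetaUpperH β' γ₀ β) : EndpointExistence Cn :=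
  endpointExistence_of_composedLegInterfacePow_identity_avg_remainderConst hgen Sβ hdeg hμν hN hval hL hwt0 hwt1 hR hS hR' hS'
    hδ hc hM hML hF hG hFtail hGtail hident
    (by
      have h := identityForm_of_specFamilies_of_symmetries Nf hNf S w T hwA hrep hTA hdiv hinv F
      intro j k hjk
      rw [hβ j]
      exact h j k hjk)
    hγ₀ hrem hr hβ' hcont hup


/-! ## §2  Zero minimiser-side binders: the wall for the typed system's own solution-operator kernels `wK (Lc^(k−j))` -/

/-- **THE WALL WITH `hid` DISCHARGED FOR THE TYPED U = 1 BLOCK-AVERAGING KKT SYSTEM.**  `EndpointExistence Cn` from the §10 averaged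
leg binders with `μC j k := F (coarseTensor (Lc^(k−j)) (wK (Lc^(k−j))) (T j))` — the coarse coefficients read out of an2's solution-operator
kernels `wK` (`KernelSpecInstance.specK`, `MinimiserIdentityForm.wK`) dressed by the Hessian kernels `T j` —, the Hessian data
`(hTA, hT0, hT1)`, ANY read-out `F`, the identification `hβ : ∀ j, Sβ.β0 j = F (m2Tensor (T j))` (the `hident` side, (D1)), and the
downstream binders.  NO spec / `hrep` / kernel binder remains: `hid` is an2's `identityForm_of_minimiserFamilies'`.  Subject to the
READING CLAUSE (W-KKT-2) of the header. [folklore] -/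
theorem endpointExistence_of_composedLegInterfacePow_minimiser_avg_remainderConst {β : HBeta} {Cn : B12.Construction}
    (hgen : ForwardGenerated Cn β) (Sβ : B12Beta.OneLoopSplit β)
    (hdeg : ∀ i ∈ s, (P i).a + (Q i).a = 6) {μ ν : Fin 4} (hμν : μ ≠ ν) {N : ℝ} (hN : N ≠ 0)
    (hval : ∀ x : E4, x ≠ 0 → x μ * x ν * contBubble s cc₀ P Q x = leadingIntegrand (kappaBal N) μ ν x)
    {Lc : ℕ} [NeZero Lc] (hL : 2 ≤ Lc) (T : ℕ → EKer 4)
    (hTA : ∀ j c e, AbsMoment₂ (T j c e)) (hT0 : ∀ j c e, HasSum (T j c e) 0)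
    (hT1 : ∀ j c e (ρ : Fin 4), HasSum (fun t : Fin 4 → ℤ => t ρ • T j c e t) 0)
    (F : (Fin 4 → Fin 4 → Fin 4 → Fin 4 → ℝ) → ℝ) (hβ : ∀ j, Sβ.β0 j = F (m2Tensor (T j)))
    {F' G' : κB → ι → ℕ → Pt → ℝ} {R Sg R' S' : ι → ℝ} {δ U cc : ℝ} {M : ℕ → ℕ}
    {Bset : ℕ → Finset κB} {wt : ℕ → κB → ℝ}
    (hwt0 : ∀ n : ℕ, 2 ≤ n → ∀ b ∈ Bset n, 0 ≤ wt n b) (hwt1 : ∀ n : ℕ, 2 ≤ n → ∑ b ∈ Bset n, wt n b = 1)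
    (hR : ∀ i ∈ s, 0 ≤ R i) (hS : ∀ i ∈ s, 0 ≤ Sg i) (hR' : ∀ i ∈ s, 0 ≤ R' i) (hS' : ∀ i ∈ s, 0 ≤ S' i) (hδ : 0 < δ)
    (hc : 1 ≤ cc) (hM : ∀ L : ℕ, 2 ≤ L → 1 ≤ M L ∧ (L : ℝ) ≤ cc * M L) (hML : ∀ L : ℕ, 2 ≤ L → M L ≤ L)
    (hF : ∀ m : ℕ, 1 ≤ m → ∀ b ∈ Bset (Lc ^ m), ∀ w' ∈ annulus 4 0 (M (Lc ^ m)), ∀ i ∈ s,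
      |F' b i (Lc ^ m) w' - (P i).f (Lc ^ m) 0 w'| ≤ R i / ((supNorm w' : ℝ) ^ ((P i).a - 2) * ((Lc ^ m : ℕ) : ℝ) ^ 2))
    (hG : ∀ m : ℕ, 1 ≤ m → ∀ b ∈ Bset (Lc ^ m), ∀ w' ∈ annulus 4 0 (M (Lc ^ m)), ∀ i ∈ s,
      |G' b i (Lc ^ m) w' - (Q i).f (Lc ^ m) 0 w'| ≤ Sg i / ((supNorm w' : ℝ) ^ ((Q i).a - 2) * ((Lc ^ m : ℕ) : ℝ) ^ 2))
    (hFtail : ∀ m : ℕ, 1 ≤ m → ∀ b ∈ Bset (Lc ^ m), ∀ r : ℕ, M (Lc ^ m) ≤ r → ∀ w' ∈ annulus 4 r (r + 1), ∀ i ∈ s,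
      |F' b i (Lc ^ m) w'| ≤ R' i / ((r : ℝ) + 1) ^ (P i).a * Real.exp (-(δ / ((Lc ^ m : ℕ) : ℝ)) * ((r : ℝ) + 1)))
    (hGtail : ∀ m : ℕ, 1 ≤ m → ∀ b ∈ Bset (Lc ^ m), ∀ r : ℕ, M (Lc ^ m) ≤ r → ∀ w' ∈ annulus 4 r (r + 1), ∀ i ∈ s,
      |G' b i (Lc ^ m) w'| ≤ S' i / ((r : ℝ) + 1) ^ (Q i).a)
    (hident : ∀ m : ℕ, 1 ≤ m → ∃ R₀ : ℕ, M (Lc ^ m) ≤ R₀ ∧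
      |composedCoeff (fun j k => F (coarseTensor (Lc ^ (k - j)) (wK (Lc ^ (k - j))) (T j))) m
        - ∑ b ∈ Bset (Lc ^ m), wt (Lc ^ m) b * ∑ w' ∈ annulus 4 0 R₀, toReal w' μ * toReal w' ν *
          ∑ i ∈ s, cc₀ i * (F' b i (Lc ^ m) w' * G' b i (Lc ^ m) w')| ≤ U)
    {rr γ₀ β' : ℝ} (hγ₀ : 0 < γ₀) (hrem : RemainderConst Sβ γ₀ rr) (hr : rr ≤ B12Normalization.stepBal N Lc)
    (hβ' : 0 ≤ β') (hcont : BetaContH γ₀ β) (hup : BetaUpperH β' γ₀ β) : EndpointExistence Cn :=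
  endpointExistence_of_composedLegInterfacePow_identity_avg_remainderConst hgen Sβ hdeg hμν hN hval hL hwt0 hwt1 hR hS hR' hS'
    hδ hc hM hML hF hG hFtail hGtail hident
    (identityForm_of_minimiserFamilies' (fun j k => Lc ^ (k - j)) T hTA hT0 hT1 F hβ)
    hγ₀ hrem hr hβ' hcont hup

/-- **… with (T0)/(T1) from the two symmetries of the Hessian kernels** (divergence-freeness + midpoint inversion, in an2's explicit
form; `MinimiserIdentityForm.identityForm_of_minimiserFamilies_of_symmetries`).  Subject to the READING CLAUSE (W-KKT-2). [folklore] -/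
theorem endpointExistence_of_composedLegInterfacePow_minimiser_avg_remainderConst_of_symmetries {β : HBeta}
    {Cn : B12.Construction} (hgen : ForwardGenerated Cn β) (Sβ : B12Beta.OneLoopSplit β)
    (hdeg : ∀ i ∈ s, (P i).a + (Q i).a = 6) {μ ν : Fin 4} (hμν : μ ≠ ν) {N : ℝ} (hN : N ≠ 0)
    (hval : ∀ x : E4, x ≠ 0 → x μ * x ν * contBubble s cc₀ P Q x = leadingIntegrand (kappaBal N) μ ν x)
    {Lc : ℕ} [NeZero Lc] (hL : 2 ≤ Lc) (T : ℕ → EKer 4) (hTA : ∀ j c e, AbsMoment₂ (T j c e))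
    (hdiv : ∀ j (ν' : Fin 4) (x : Fin 4 → ℤ), ∑ μ', (T j μ' ν' x - T j μ' ν' (x - Pi.single μ' 1)) = 0)
    (hinv : ∀ j (μ' ν' : Fin 4) (y : Fin 4 → ℤ), T j μ' ν' ((Pi.single ν' 1 - Pi.single μ' 1) - y) = T j μ' ν' y)
    (F : (Fin 4 → Fin 4 → Fin 4 → Fin 4 → ℝ) → ℝ) (hβ : ∀ j, Sβ.β0 j = F (m2Tensor (T j)))
    {F' G' : κB → ι → ℕ → Pt → ℝ} {R Sg R' S' : ι → ℝ} {δ U cc : ℝ} {M : ℕ → ℕ}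
    {Bset : ℕ → Finset κB} {wt : ℕ → κB → ℝ}
    (hwt0 : ∀ n : ℕ, 2 ≤ n → ∀ b ∈ Bset n, 0 ≤ wt n b) (hwt1 : ∀ n : ℕ, 2 ≤ n → ∑ b ∈ Bset n, wt n b = 1)
    (hR : ∀ i ∈ s, 0 ≤ R i) (hS : ∀ i ∈ s, 0 ≤ Sg i) (hR' : ∀ i ∈ s, 0 ≤ R' i) (hS' : ∀ i ∈ s, 0 ≤ S' i) (hδ : 0 < δ)
    (hc : 1 ≤ cc) (hM : ∀ L : ℕ, 2 ≤ L → 1 ≤ M L ∧ (L : ℝ) ≤ cc * M L) (hML : ∀ L : ℕ, 2 ≤ L → M L ≤ L)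
    (hF : ∀ m : ℕ, 1 ≤ m → ∀ b ∈ Bset (Lc ^ m), ∀ w' ∈ annulus 4 0 (M (Lc ^ m)), ∀ i ∈ s,
      |F' b i (Lc ^ m) w' - (P i).f (Lc ^ m) 0 w'| ≤ R i / ((supNorm w' : ℝ) ^ ((P i).a - 2) * ((Lc ^ m : ℕ) : ℝ) ^ 2))
    (hG : ∀ m : ℕ, 1 ≤ m → ∀ b ∈ Bset (Lc ^ m), ∀ w' ∈ annulus 4 0 (M (Lc ^ m)), ∀ i ∈ s,
      |G' b i (Lc ^ m) w' - (Q i).f (Lc ^ m) 0 w'| ≤ Sg i / ((supNorm w' : ℝ) ^ ((Q i).a - 2) * ((Lc ^ m : ℕ) : ℝ) ^ 2))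
    (hFtail : ∀ m : ℕ, 1 ≤ m → ∀ b ∈ Bset (Lc ^ m), ∀ r : ℕ, M (Lc ^ m) ≤ r → ∀ w' ∈ annulus 4 r (r + 1), ∀ i ∈ s,
      |F' b i (Lc ^ m) w'| ≤ R' i / ((r : ℝ) + 1) ^ (P i).a * Real.exp (-(δ / ((Lc ^ m : ℕ) : ℝ)) * ((r : ℝ) + 1)))
    (hGtail : ∀ m : ℕ, 1 ≤ m → ∀ b ∈ Bset (Lc ^ m), ∀ r : ℕ, M (Lc ^ m) ≤ r → ∀ w' ∈ annulus 4 r (r + 1), ∀ i ∈ s,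
      |G' b i (Lc ^ m) w'| ≤ S' i / ((r : ℝ) + 1) ^ (Q i).a)
    (hident : ∀ m : ℕ, 1 ≤ m → ∃ R₀ : ℕ, M (Lc ^ m) ≤ R₀ ∧
      |composedCoeff (fun j k => F (coarseTensor (Lc ^ (k - j)) (wK (Lc ^ (k - j))) (T j))) m
        - ∑ b ∈ Bset (Lc ^ m), wt (Lc ^ m) b * ∑ w' ∈ annulus 4 0 R₀, toReal w' μ * toReal w' ν *
          ∑ i ∈ s, cc₀ i * (F' b i (Lc ^ m) w' * G' b i (Lc ^ m) w')| ≤ U)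
    {rr γ₀ β' : ℝ} (hγ₀ : 0 < γ₀) (hrem : RemainderConst Sβ γ₀ rr) (hr : rr ≤ B12Normalization.stepBal N Lc)
    (hβ' : 0 ≤ β') (hcont : BetaContH γ₀ β) (hup : BetaUpperH β' γ₀ β) : EndpointExistence Cn :=
  endpointExistence_of_composedLegInterfacePow_identity_avg_remainderConst hgen Sβ hdeg hμν hN hval hL hwt0 hwt1 hR hS hR' hS'
    hδ hc hM hML hF hG hFtail hGtail hident
    (by
      have h := identityForm_of_minimiserFamilies_of_symmetries (fun j k => Lc ^ (k - j)) T hTA hdiv hinv F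
      intro j k hjk
      rw [hβ j]
      exact h j k hjk)
    hγ₀ hrem hr hβ' hcont hup

end Literature.MathematicalPhysics.QuantumFieldTheory.Balaban1983to89.Beta.ComposedRoadFromSpec
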